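import Mathlib
import Literature.Computability.Complexity.ConstantDepth
import Literature.Computability.Complexity.CircuitRestriction
import Literature.Computability.Complexity.TC0SubsetNC1Reduction
import HarnessLib

/-!
# Crux `MobiusLadder.LiouvilleOrthogonalTC0` (stmt-QuantumAdvantage-1393), line `Sketch`:
# stub `stub_depthOne_ltf` — depth-one threshold circuits are integer linear threshold functions

A circuit over `tcBasis = {¬} ∪ {∧ₖ, ∨ₖ, MAJₖ : k ∈ ℕ}` with `acDepth ≤ 1` (negation gates weigh
`0`, every other gate `1`) computes an INTEGER LINEAR THRESHOLD FUNCTION of its inputs,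
`x ↦ [θ ≤ Σ_i w_i x_i]` with `w : Fin n → ℤ`, `θ : ℤ`.

Proof (structural, on the straight-line program `C.gates`, by reverse induction): for every valid
wire `u` of a well-formed program over `tcBasis`,

* if `u` has `acWeight`-depth `0` it carries an *affine literal*: `[u(x)] = t + s·[x i]` for some
  input `i` and integers `s, t` (an input wire, or a `¬` gate — the only gate of weight `0` — whose
  unique relevant argument again has depth `0`);
* if `u` has `acWeight`-depth `≤ 1` it carries an integer LTF: either a `¬` gate applied to a wire of
  depth `≤ 1` (`¬[θ ≤ L] = [1 - θ ≤ -L]` over `ℤ`), or a gate `∧ₖ / ∨ₖ / MAJₖ`, which is a threshold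
  `[θ ≤ c · #ones]` of its arguments (`exists_threshold_of_mem_tcBasis`), all of depth `0`, hence
  affine literals, so that `c · #ones = c·Σ_a (t_a + s_a [x (i a)])` is an affine form in `x`
  (collecting the coefficients fiberwise over the inputs).

Applied to the output wire (`circuit_eval`, `circuit_depthWith`) this is `stub_depthOne_ltf`.
-/

set_option linter.dupNamespace false -- D-0017: single-problem summit ⇒ `QuantumAdvantage.QuantumAdvantage` by design

namespace Summit.QuantumAdvantage.QuantumAdvantage.Theorems.LiouvilleOrthogonalTC0

open Finset
open Literature.Computability.Complexity
open Literature.Computability.Complexity.GateList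

namespace DepthOneLtf

variable {n : ℕ}

/-- An input variable `x i` is the linear threshold function `[1 ≤ x_i]`. -/
theorem ltf_input (i : Fin n) :
    ∃ (w : Fin n → ℤ) (θ : ℤ), ∀ x : Fin n → Bool,
      x i = decide (θ ≤ ∑ j, w j * (if x j then (1 : ℤ) else 0)) := by
  refine ⟨Pi.single i 1, 1, fun x => ?_⟩
  have hs : ∑ j, (Pi.single i (1 : ℤ) : Fin n → ℤ) j * (if x j then (1 : ℤ) else 0) =
      if x i then (1 : ℤ) else 0 := by
    rw [Finset.sum_eq_single i]
    · simp
    · intro j _ hj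
      simp [Pi.single_eq_of_ne hj]
    · intro h
      exact absurd (mem_univ i) h
  rw [hs]
  cases x i <;> simp

/-- The negation of an integer linear threshold function is one: `¬[θ ≤ L] = [1 - θ ≤ -L]`. -/
theorem ltf_not {f : (Fin n → Bool) → Bool}
    (hf : ∃ (w : Fin n → ℤ) (θ : ℤ), ∀ x : Fin n → Bool,
      f x = decide (θ ≤ ∑ j, w j * (if x j then (1 : ℤ) else 0))) :
    ∃ (w : Fin n → ℤ) (θ : ℤ), ∀ x : Fin n → Bool,
      (!f x) = decide (θ ≤ ∑ j, w j * (if x j then (1 : ℤ) else 0)) := by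
  obtain ⟨w, θ, hf⟩ := hf
  refine ⟨fun j => -w j, 1 - θ, fun x => ?_⟩
  rw [hf]
  simp only [neg_mul, Finset.sum_neg_distrib]
  rw [Bool.eq_iff_iff]
  simp only [Bool.not_eq_true', decide_eq_false_iff_not, decide_eq_true_eq]
  omega

/-- The negation of an affine literal is an affine literal: `[¬ℓ] = 1 - [ℓ]`. -/
theorem lit_not {f : (Fin n → Bool) → Bool}
    (hf : ∃ (i : Fin n) (s t : ℤ), ∀ x : Fin n → Bool,
      (if f x then (1 : ℤ) else 0) = t + s * (if x i then (1 : ℤ) else 0)) :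
    ∃ (i : Fin n) (s t : ℤ), ∀ x : Fin n → Bool,
      (if (!f x) then (1 : ℤ) else 0) = t + s * (if x i then (1 : ℤ) else 0) := by
  obtain ⟨i, s, t, hf⟩ := hf
  refine ⟨i, -s, 1 - t, fun x => ?_⟩
  have e : (if (!f x) then (1 : ℤ) else 0) = 1 - (if f x then (1 : ℤ) else 0) := by
    cases f x <;> simp
  rw [e, hf x]
  ring

/-- Collecting a sum over argument positions fiberwise over the inputs they read:
`Σ_a s_a · y (i a) = Σ_j (Σ_{a : i a = j} s_a) · y j`. -/
theorem sum_fiber_mul {k : ℕ} (s : Fin k → ℤ) (i : Fin k → Fin n) (y : Fin n → ℤ) :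
    ∑ a, s a * y (i a) = ∑ j, (∑ a ∈ univ.filter (fun a => i a = j), s a) * y j := by
  rw [← Finset.sum_fiberwise univ i (fun a => s a * y (i a))]
  refine Finset.sum_congr rfl fun j _ => ?_
  rw [Finset.sum_mul]
  refine Finset.sum_congr rfl fun a ha => ?_
  rw [(Finset.mem_filter.1 ha).2]

/-- A `¬` gate reads one argument and negates it. -/
theorem op_eq_not_of_fn_eq_not {ι : Type*} (g : Gate ι) (h : g.fn = GateFn.not) :
    ∃ a₀ : Fin g.arity, ∀ v, g.op v = !(v a₀) := by
  obtain ⟨k, op, args⟩ := g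
  simp only [Gate.fn, GateFn.not, Sigma.mk.inj_iff] at h
  obtain ⟨rfl, hop⟩ := h
  cases hop
  exact ⟨0, fun v => rfl⟩

/-- A gate of `tcBasis` other than `¬`, applied to affine literals, computes an integer linear
threshold function: it is `[θ ≤ c · #ones]` of its arguments and `#ones` is affine in `x`. -/
theorem ltf_gate (g : Gate (Fin n)) (hg : g.fn ∈ tcBasis) (hne : g.fn ≠ GateFn.not)
    (v : Fin g.arity → (Fin n → Bool) → Bool)
    (hv : ∀ a, ∃ (i : Fin n) (s t : ℤ), ∀ x : Fin n → Bool,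
      (if v a x then (1 : ℤ) else 0) = t + s * (if x i then (1 : ℤ) else 0)) :
    ∃ (w : Fin n → ℤ) (θ : ℤ), ∀ x : Fin n → Bool,
      g.op (fun a => v a x) = decide (θ ≤ ∑ j, w j * (if x j then (1 : ℤ) else 0)) := by
  choose i s t hv using hv
  obtain ⟨θ, c, -, hthr⟩ := exists_threshold_of_mem_tcBasis hg hne
  refine ⟨fun j => (c : ℤ) * ∑ a ∈ univ.filter (fun a => i a = j), s a,
    (θ : ℤ) - c * ∑ a, t a, fun x => ?_⟩
  have h1 : g.op (fun a => v a x) = decide (θ ≤ c * GateFn.numOnes (fun a => v a x)) := hthr _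
  have h2 : (GateFn.numOnes (fun a => v a x) : ℤ) =
      ∑ a, t a + ∑ a, s a * (if x (i a) then (1 : ℤ) else 0) := by
    unfold GateFn.numOnes
    rw [Finset.natCast_card_filter, ← Finset.sum_add_distrib]
    exact Finset.sum_congr rfl fun a _ => hv a x
  have h3 := sum_fiber_mul s i (fun j => if x j then (1 : ℤ) else 0)
  beta_reduce at h3
  have h4 : ∑ j, ((c : ℤ) * ∑ a ∈ univ.filter (fun a => i a = j), s a) * (if x j then (1 : ℤ) else 0)
      = (c : ℤ) * ∑ j, (∑ a ∈ univ.filter (fun a => i a = j), s a) * (if x j then (1 : ℤ) else 0) := by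
    rw [Finset.mul_sum]
    exact Finset.sum_congr rfl fun j _ => mul_assoc _ _ _
  rw [h1, decide_eq_decide, ← Nat.cast_le (α := ℤ), Nat.cast_mul, h2, h3, h4, mul_add,
    sub_le_iff_le_add']

/-- **The wire invariant.** In a well-formed program over `tcBasis`, every valid wire of
`acWeight`-depth `0` carries an affine literal `[u(x)] = t + s·[x i]`, and every valid wire of
`acWeight`-depth `≤ 1` carries an integer linear threshold function `[θ ≤ Σ_j w_j x_j]`. -/
theorem wire_invariant (gs : List (Gate (Fin n))) (hwf : WF gs) (hB : ∀ g ∈ gs, g.fn ∈ tcBasis)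
    (u : Fin n ⊕ ℕ) (hu : OutOK gs.length u) :
    (wireDepthOf (wdepths acWeight gs) u = 0 →
      ∃ (i : Fin n) (s t : ℤ), ∀ x : Fin n → Bool,
        (if wireOf x (vals gs x) u then (1 : ℤ) else 0) = t + s * (if x i then (1 : ℤ) else 0)) ∧
    (wireDepthOf (wdepths acWeight gs) u ≤ 1 →
      ∃ (w : Fin n → ℤ) (θ : ℤ), ∀ x : Fin n → Bool,
        wireOf x (vals gs x) u = decide (θ ≤ ∑ j, w j * (if x j then (1 : ℤ) else 0))) := by
  induction gs using List.reverseRecOn generalizing u with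
  | nil =>
    cases u with
    | inl i =>
      exact ⟨fun _ => ⟨i, 1, 0, fun x => by simp⟩,
        fun _ => by simpa only [wireOf_inl] using ltf_input i⟩
    | inr m => exact absurd (hu m rfl) (Nat.not_lt_zero m)
  | append_singleton gs g ih =>
    have hwf' : WF gs := hwf.of_append_left
    have hB' : ∀ g' ∈ gs, g'.fn ∈ tcBasis := fun g' hg' => hB g' (List.mem_append_left _ hg')
    have hgB : g.fn ∈ tcBasis := hB g (List.mem_append_right _ (List.mem_singleton_self g))
    have hOK : GateOK gs.length g := hwf.getLast
    have hargs : ∀ a, OutOK gs.length (g.args a) := fun a m h => hOK a m h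
    cases u with
    | inl i =>
      exact ⟨fun _ => ⟨i, 1, 0, fun x => by simp⟩,
        fun _ => by simpa only [wireOf_inl] using ltf_input i⟩
    | inr m =>
      have hm : m < gs.length + 1 := by simpa using hu m rfl
      rcases Nat.lt_succ_iff_lt_or_eq.1 hm with hlt | rfl
      · -- a gate of the prefix: values and depths are unchanged
        have hu' : OutOK gs.length (.inr m : Fin n ⊕ ℕ) := fun m' h => by cases h; exact hlt
        have hval : ∀ x, wireOf x (vals (gs ++ [g]) x) (.inr m) = wireOf x (vals gs x) (.inr m) :=
          fun x => wireOf_vals_append gs [g] x _ hu'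
        have hdep : wireDepthOf (wdepths acWeight (gs ++ [g])) (.inr m : Fin n ⊕ ℕ) =
            wireDepthOf (wdepths acWeight gs) (.inr m) :=
          wireDepthOf_wdepths_append acWeight gs [g] _ hu'
        rw [hdep]
        simp only [hval]
        exact ih hwf' hB' _ hu'
      · -- the new gate
        have hval : ∀ x, wireOf x (vals (gs ++ [g]) x) (.inr gs.length) =
            g.op (fun a => wireOf x (vals gs x) (g.args a)) :=
          fun x => by rw [wireOf_inr, getD_vals_append_singleton]
        have hdep : wireDepthOf (wdepths acWeight (gs ++ [g])) (.inr gs.length : Fin n ⊕ ℕ) =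
            acWeight g.fn + univ.sup fun a => wireDepthOf (wdepths acWeight gs) (g.args a) := by
          rw [wireDepthOf_inr, getD_wdepths_append_singleton]
        have hle : ∀ a, wireDepthOf (wdepths acWeight gs) (g.args a) ≤
            univ.sup fun a => wireDepthOf (wdepths acWeight gs) (g.args a) := fun a =>
          Finset.le_sup (f := fun a => wireDepthOf (wdepths acWeight gs) (g.args a)) (mem_univ a)
        rw [hdep]
        simp only [hval]
        constructor
        · -- depth `0`: a `¬` gate on a depth-`0` wire
          intro h0
          have hw0 : acWeight g.fn = 0 := by omega
          have hnot : g.fn = GateFn.not := by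
            by_contra hne
            simp [acWeight, hne] at hw0
          obtain ⟨a₀, hop⟩ := op_eq_not_of_fn_eq_not g hnot
          have ha0 : wireDepthOf (wdepths acWeight gs) (g.args a₀) = 0 := by
            have := hle a₀
            omega
          simp only [hop]
          exact lit_not ((ih hwf' hB' (g.args a₀) (hargs a₀)).1 ha0)
        · intro h1
          by_cases hnot : g.fn = GateFn.not
          · -- a `¬` gate on a wire of depth `≤ 1`
            obtain ⟨a₀, hop⟩ := op_eq_not_of_fn_eq_not g hnot
            have ha0 : wireDepthOf (wdepths acWeight gs) (g.args a₀) ≤ 1 := by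
              have := hle a₀
              omega
            simp only [hop]
            exact ltf_not ((ih hwf' hB' (g.args a₀) (hargs a₀)).2 ha0)
          · -- a threshold gate of `tcBasis` on literals
            have hw1 : acWeight g.fn = 1 := by simp [acWeight, hnot]
            have hsup : ∀ a, wireDepthOf (wdepths acWeight gs) (g.args a) = 0 := by
              intro a
              have := hle a
              omega
            exact ltf_gate g hgB hnot (fun a x => wireOf x (vals gs x) (g.args a))
              (fun a => (ih hwf' hB' (g.args a) (hargs a)).1 (hsup a))

end DepthOneLtf

/-- **Stub `stub_depthOne_ltf` (line `Sketch`, crux `LiouvilleOrthogonalTC0`) — depth-one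
threshold circuits are integer linear threshold functions.** A circuit over `tcBasis`
(`∧ₖ`, `∨ₖ`, `¬`, `MAJₖ`) with `acDepth ≤ 1` (negations free) computes `x ↦ [θ ≤ Σ_i w_i x_i]` for
some integer weights `w` and threshold `θ`: wires of depth `0` are (affine) literals, a weight-`1`
gate of `tcBasis` is `[θ ≤ c·#ones]` of its literal arguments — an affine form in `x` — and the
class is closed under `¬` (`¬[θ ≤ L] = [1 - θ ≤ -L]` over `ℤ`). -/
theorem stub_depthOne_ltf {n : ℕ} (C : Circuit (Fin n)) (hB : C.IsOver tcBasis)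
    (hd : C.acDepth ≤ 1) :
    ∃ (w : Fin n → ℤ) (θ : ℤ), ∀ x : Fin n → Bool,
      C.eval x = decide (θ ≤ ∑ i, w i * (if x i then (1 : ℤ) else 0)) := by
  have hinv := (DepthOneLtf.wire_invariant C.gates (wf_gates C) hB C.output C.wf_output).2
  rw [Circuit.acDepth, circuit_depthWith] at hd
  obtain ⟨w, θ, h⟩ := hinv hd
  exact ⟨w, θ, fun x => by rw [circuit_eval]; exact h x⟩

end Summit.QuantumAdvantage.QuantumAdvantage.Theorems.LiouvilleOrthogonalTC0
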